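import Summits.KontsevichZagierPeriods.KontsevichZagierPeriods.Theses.FermatIsogeny
import Literature.NumberTheory.Transcendental.GammaMonomialsProofs
import Literature.NumberTheory.Transcendental.KZCubeProducts
import Literature.NumberTheory.Transcendental.KZCalculusProofs
import Literature.NumberTheory.Transcendental.KZSemiCanonicalReductionProofs
import Literature.NumberTheory.Transcendental.KZRelationsLE
import Literature.NumberTheory.Transcendental.KZKernelConjectureForms
import Literature.NumberTheory.Transcendental.KZGaussMultiplicationChain
import Literature.NumberTheory.Transcendental.KZMellinFibres
import Literature.NumberTheory.Transcendental.KZDominatedFamilyRelations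
import Literature.NumberTheory.Transcendental.KZBallPeelingAux
import Literature.Analysis.SpecialFunctions.SelbergIntegralBasic
import Literature.NumberTheory.Transcendental.LindemannWeierstrassProofs

/-! # `FermatIsogenyDeepWordSectorP01` — part 1/9 of the mechanical ≤400-line split of `DeepWordSector.lean` (sha256 5e8cd5c1c920648a…)
Source: decomp-kz lens-5 g22 DeepWordSector.lean v10 @5e8cd5c1 (the deep Beta-word sector node: bridge S ⟺ BetaWordTower ∧ WordSectorComplete, finite boxes, box ladder, shadow arithmetic, Chudnovsky levels; critic CLEARED g6-2/3/4/11/13/16/19); --supports stmt-KontsevichZagierPeriods-3898.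
Split by census-1 g10 `gen/splitlean.py`: scopes re-opened with their `open`/`variable`/`set_option` context; mathematics and declaration order unchanged. -/

/-!
# The `k`-LETTER BETA-WORD SECTOR (uniform family through `BetaLinearSector` 3897 = `k = 1` and `BetaProductSector`
# 3898 = `k = 2`) and the first deep class OUTSIDE 3897/3898: `a_{5·13}` (level 65), a (3,3) Beta-word pair PINNED with
# its Koblitz–Ogus and denominator-2 certificates discharged (decomp-kz · lens-5 · g21, census (α))

Census g21 (α) (`instrument/den2_pq.py`, exhaustive over all letters `B(a/N,b/N)`): the deep class `a_{p·q}` of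
`tors(H_N/S_N) ≅ 𝔽₂` (`N = pq`, `5 ≤ p < q` prime) is the Γ-class difference of two TWO-letter products at `N = 35, 55`
(`Deep35`, `Deep55`), but at `N = 65` and `N = 77` NO pair of two-letter products of equal fine Hodge type realises it —
three letters are needed (and at least three at `91, 95`, at least four at `85`).  So the typed sector statements of route
FermatIsogeny, `BetaLinearSector` (`IntegralRep 1`) and `BetaProductSector` (`IntegralRep 2`), contain no target pinning
`a_{5·13}` at its own level.  This file
* types the uniform family `BetaWordSector k` — Conjecture 1 for a pair of `k`-dimensional representations on `(0,1)^k`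
  with integrands `∏ᵢ xᵢ^{aᵢ−1}(1−xᵢ)^{bᵢ−1}` and `q·∏ᵢ xᵢ^{a′ᵢ−1}(1−xᵢ)^{b′ᵢ−1}`, `aᵢ, bᵢ, a′ᵢ, b′ᵢ ∈ ℚ_{>0}`, `q` real
  algebraic, equal values — and PROVES `BetaWordSector 1 ↔ BetaLinearSector`, `BetaWordSector 2 ↔ BetaProductSector`
  (pure reindexing), so that `BetaWordSector 3` is the literal next member of the route's own family;
* PROVES the family is a TOWER: `betaWordSector_anti : BetaWordSector (k+1) → BetaWordSector k` (pad both words with the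
  letter `B(1,1) = ∫₀¹dt = 1`; the padded representation on `(0,1)^{k+1}` is a null modification of the closed slab
  `σ × [0,1]`, which is ONE Newton–Leibniz move away from the `k`-dimensional one — `of_sub_of_mem_relations_of_pad`, built
  on the tree's `KZ.IntegralRep.of_slab_sub_of_mem_newtonLeibnizRel` and `KZ.of_sub_of_mem_relations_of_null`), whence
  `betaWordSector_of_le : k ≤ l → BetaWordSector l → BetaWordSector k` and `BetaWordSector 3 → BetaProductSector ∧
  BetaLinearSector`; the case `k = 1` of the tower re-derives the tree's
  `FermatIsogeny.BetaLinearOfProduct.betaLinearSector_of_betaProductSector` (crux 3898 ⟹ crux 3897, there via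
  `β(1,1) = 1` in `P` and the `betaClass` API; here by the direct slab move, uniformly in `k`);
* PROVES THE BRIDGE `summit_iff_betaWordTower_and_wordSectorComplete : KontsevichZagierPeriods ↔ BetaWordTower ∧
  WordSectorComplete` — a certified conjunct split of the summit in which ALL the Beta/Γ-content (every deep class of census
  (α), in its own word length) sits in the tower `BetaWordTower := ∀ k, BetaWordSector k` (⟺ `S_word ⊆ relations`,
  `betaWordTower_iff_wordPairs_subset`) and the complement `WordSectorComplete` (completeness of the calculus modulo the word
  pairs `S_word ⊇ S_lin ∪ S_prod`, `linProdPairs_subset_wordPairs`) is WEAKER than crux 14252 `FermatSectorComplete`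
  (`wordSectorComplete_of_fermatSectorComplete`) — versus the tree's `closes_without_betaLinear : BetaProductSector →
  FermatSectorComplete → KontsevichZagierPeriods`, where the word pairs of length `≥ 3` hide inside the completeness crux;
* pins `Deep65 : Prop` — the smallest (3,3) representative of `a_{5·13}` (census: none with numerators ≤ 20; this one has
  numerators ≤ 24, all six letters in the simplex):

  `B(1/65,11/65)·B(3/65,16/65)·B(8/65,24/65) = c₆₅ · B(2/65,24/65)·B(4/65,17/65)·B(5/65,15/65)`,
  `c₆₅ = Γ(1)Γ(3)Γ(8)Γ(11)Γ(16)Γ(20)Γ(21)Γ(26) / (Γ(2)Γ(4)Γ(5)Γ(12)Γ(15)Γ(17)Γ(19)Γ(32))` (arguments `/65`) `= 1.5899322121589…`,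

  with `deep65_of_betaWordSector : BetaWordSector 3 → Deep65`, the KO certificate `isHodgeType65` (`decide` on `u mod 65`),
  `constant65_isAlgebraic` (tree's `deligne_gammaMonomial_algebraic_holds`), and the EXPLICIT den-2 certificate
  `den_two_65_explicit` (`17` reflections + `8` distribution relations: Gauss₁₃-fibres at `y = 1, 2` and Gauss₅-fibres at
  `y = 1,…,6`; BOTH orders needed, census) checked by `decide` — so the SQUARE of this pair is again a standard identity
  and the pair costs ONE pointed binomial cancellation (the square door of `SlackSquare.lean` §26, now for a 3-letter word).
* PROVES THE FINITE BOXES (the «finite/base range» of the lens made literal): `betaWordSector_iff_levels :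
  BetaWordSector k ↔ ∀ N > 0, BetaWordSectorLevel k N`, where the `(k, N)` box `BetaWordSectorLevel k N` quantifies over the
  FINITE type `(Fin k → Fin N)⁴` of exponent patterns `(uᵢ+1)/N ∈ {1/N,…,1}` — via `betaWordSector_iff_reduced` (all `4k`
  exponents reduced to the fundamental domain `(0,1]` of `a ↦ a+1`: letter by letter in `P`, `word_reduce :
  ∏ β(aⱼ,bⱼ) = κ(C)·∏ β(red aⱼ, red bⱼ)`, values transported through `KZ.evalP`, the second representation rescaled by the
  quotient of the two reduction constants) and `betaWordSectorReduced_iff_level` (common denominator).  The two elementary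
  Beta moves this uses — reflection `t ↦ 1−t` and translation (integration by parts as ONE Newton–Leibniz move) — enter as
  the HYPOTHESES `BetaReflectionMove`, `BetaTranslationMove`, which are VERBATIM the statements of the Literature theorems
  `KZ.betaReflection_equivalent`, `KZ.betaTranslation_equivalent` (`KZBetaChains.lean`; that cone is unbuilt on the farm at
  the time of writing, so its PROVED text is vendored verbatim in the sub-namespace `BetaMoves` below — its own imports are
  fresh — and the hypotheses are DISCHARGED in this file: `betaReflectionMove_holds`, `betaTranslationMove_holds`).  Hence,
  UNCONDITIONALLY, `betaWordSector_iff_levels' : BetaWordSector k ↔ ∀ N > 0, BetaWordSectorLevel k N`,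
  `betaProductSector_iff_levels' : BetaProductSector ↔ ∀ N > 0, BetaWordSectorLevel 2 N`, `betaLinearSector_iff_levels'` and
  `summit_iff_levels_and_wordSectorComplete : KontsevichZagierPeriods ↔ (∀ k N, 0 < N → BetaWordSectorLevel k N) ∧
  WordSectorComplete`.  The first rung of the box ladder is PROVED: `betaWordSectorLevel_one : ∀ k, BetaWordSectorLevel k 1`
  (constant integrands on the unit cube), so `betaWordSector_iff_levels_two_le : BetaWordSector k ↔ ∀ N ≥ 2, BetaWordSectorLevel k N`.
No proof hole, no new axiom; imports: `Theses.FermatIsogeny`, `Literature…{GammaMonomialsProofs, KZCubeProducts, KZCalculusProofs,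
KZSemiCanonicalReductionProofs, KZRelationsLE, KZKernelConjectureForms, KZGaussMultiplicationChain, KZMellinFibres,
KZDominatedFamilyRelations, KZBallPeelingAux}`, `Literature.Analysis.SpecialFunctions.SelbergIntegralBasic` (all fresh on the farm).

v7 (decomp-kz · lens-5 · g22) — THE LEVEL AXIS FACTORS (pure insertions after the v6 text; see the `## v7` section at the end of the file):
letter values `bval a b = B(a,b) = Γ(a)Γ(b)/Γ(a+b)` (`bval_eq`, Euler's integral via `SelbergIntegralBasic`) and word values (`word_value`);
the DICHOTOMY of every `(k,N)` box along a pattern predicate `T` — `box_iff_boxChain_and_coChain` (exact), `box_iff_boxChain :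
BoxTranscendence k N T → (BetaWordSectorLevel k N ↔ BoxChain k N T)` (the algebraic factor IS the value ratio, `eq_ratio_of_value_eq`);
RUNG `(k,2)` PROVED for every `k` (`betaWordSectorLevel_two`: letters `β(1,1) = 1`, `β(½,1) = β(1,½) = κ(2)` by the vendored move
`BetaMoves.betaFirst_equivalent_unit_constMul`, `β(½,½)` of value `π`; chains = `κ`-algebra, shadow = Lindemann via the tree theorem
`transcendental_pi_holds`), hence `BetaWordSector k ↔ ∀ N ≥ 3, BetaWordSectorLevel k N`; the DKO predicate `SameType N` (tree notion
`IsHodgeTypeGammaMonomial`), `sameType_two_iff` (at `N = 2` it is the π-count), the typed shadows `WolfartWustholzPairs` (a 1985 THEOREM,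
(cite Waldschmidt2006, p.441)) and `RohrlichLangShadow k` (a case of (cite Waldschmidt2006, Conjecture 21); open for `k ≥ 2`, `N = 5`, `N ≥ 7`), with
`betaLinearSector_iff_sameTypeChains : WolfartWustholzPairs → (BetaLinearSector ↔ ∀ N > 0, BoxChain 1 N (SameType N))` and
`betaProductSector_iff_sameTypeChains : RohrlichLangShadow 2 → (BetaProductSector ↔ ∀ N > 0, BoxChain 2 N (SameType N))`.
v7 adds ONE import, `Literature.NumberTheory.Transcendental.LindemannWeierstrassProofs` (fresh on the farm); still no proof hole, no new axiom.

v8 (decomp-kz · lens-5 · g22, addendum 1) — THE SHADOW IS Γ-ARITHMETIC (pure insertion after the v7 text, section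
`ShadowArithmetic`): word ratios are positive rationals times Γ-monomials `Π_{0<m<N} Γ(m/N)^{pairMult m}`
(`ratio_eq_rat_mul_monomial`); the Koblitz–Ogus direction `isAlgebraic_ratio_of_sameType` (tree Deligne, real form
`isAlgebraic_monomial_of_hodgeType_zero`); the CONSTANT-TYPE SHADOW PROVED AT EVERY LEVEL from tree Deligne + tree Lindemann
(`transcendental_monomial_of_constType`, `transcendental_ratio_of_constType`, `boxTranscendence_notConstType`) and the
unconditional `box_iff_boxChain_notConstType : BetaWordSectorLevel k N ↔ BoxChain k N (NotConstType N)` (`1 < N`); the typed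
Γ-conjecture `RohrlichHodge` (Hodge-type form of (cite Waldschmidt2006, Conjecture 21) ⊗ ℚ, OPEN, hypothesis only) with
`rohrlichLangShadow_of_rohrlichHodge : RohrlichHodge → ∀ k, RohrlichLangShadow k` and
`betaProductSector_iff_sameTypeChains_of_rohrlichHodge : RohrlichHodge → (BetaProductSector ↔ ∀ N > 0, BoxChain 2 N (SameType N))`.
No new import; still no proof hole, no new axiom.

v9 (decomp-kz · lens-5 · g22, addendum 2) — THE SHADOW LEVEL BY LEVEL (pure insertion after the v8 text, section
`ChudnovskyLevels`): `RohrlichHodgeAt N` (the level-`N` slice; `rohrlichHodge_iff_forall`),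
`boxTranscendence_sameType_of_rohrlichHodgeAt`, `betaWordSectorLevel_iff_of_rohrlichHodgeAt : 0 < N → RohrlichHodgeAt N →
(BetaWordSectorLevel k N ↔ BoxChain k N (SameType N))`; `rohrlichHodgeAt_two` PROVED (Lindemann); the φ(N) = 2 levels modulo
Chudnovsky's 1976 theorem typed as the hypotheses `GammaThirdPiIndep` / `GammaQuarterPiIndep` (multiplicative independence of
`Γ(⅓), π` resp. `Γ(¼), π` mod ℚ̄ˣ; (cite Waldschmidt2006, Theorem 14); hypotheses only): `rohrlichHodgeAt_three_of`,
`rohrlichHodgeAt_four_of`, `rohrlichHodgeAt_six_of` (reflection, `Γ(½) = √π`, Legendre duplication at ⅙: `Gamma_two_thirds`,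
`Gamma_three_quarters`, `Gamma_one_sixth`, `Gamma_one_sixth_mul_Gamma_five_sixths`), hence `betaWordSectorLevel_three_iff`,
`betaWordSectorLevel_four_iff`, `betaWordSectorLevel_six_iff` and a second proof of rung (k,2) (`betaWordSectorLevel_two_iff_sameType`).
No new import; still no proof hole, no new axiom.

v10 (decomp-kz · lens-5 · g22, addendum 3) — CHUDNOVSKY TYPED FAITHFULLY (pure insertion after the v9 text, section
`ChudnovskyFaithful`; answers critic g6-11/g6-13): `ChudnovskyGammaThird := AlgebraicIndependent ℚ ![Γ(⅓), π]`,
`ChudnovskyGammaQuarter := AlgebraicIndependent ℚ ![Γ(¼), π]` — the printed Theorem 14 verbatim, HYPOTHESES (never facts);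
the general PROVED lemma `transcendental_zpow_mul_zpow_of_algebraicIndependent` (algebraic independence of `x, y ≠ 0` ⟹
`x^a y^b ∉ ℚ̄` for `(a,b) ≠ 0`, via `AlgebraicIndependent.transcendental_adjoin` + `IsAlgebraic.extendScalars/mul/of_mul/of_pow`);
`gammaThirdPiIndep_of_chudnovsky`, `gammaQuarterPiIndep_of_chudnovsky`, `rohrlichHodgeAt_{three,four,six}_of_chudnovsky`,
`betaWordSectorLevel_three_six_iff_of_chudnovsky`, `betaWordSectorLevel_four_iff_of_chudnovsky`, and the base-range
statement `betaProductSector_iff_baseRange_of_chudnovsky : … → (BetaProductSector ↔ (BoxChain 2 3 (SameType 3) ∧ BoxChain 2 4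
(SameType 4) ∧ BoxChain 2 6 (SameType 6)) ∧ ∀ N ≥ 3, N ∉ {3,4,6} → BetaWordSectorLevel 2 N)`.
No new import; still no proof hole, no new axiom.
-/

namespace Summit.KontsevichZagierPeriods.FermatIsogeny.DeepTargets

open Literature.NumberTheory.Transcendental MeasureTheory
open Summit.KontsevichZagierPeriods.KontsevichZagierPeriods.Theses.FermatIsogeny (BetaLinearSector BetaProductSector FermatSectorComplete)

/-! ### The `k`-letter Beta-word sector -/

/-- **`k`-letter Beta-word sector of Conjecture 1**: for exponent vectors `a b a' b' : Fin k → ℚ_{>0}` and a real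
algebraic `q`, any representation on the open cube `(0,1)^k` with integrand `∏ᵢ xᵢ^{aᵢ−1}(1−xᵢ)^{bᵢ−1}` (value
`∏ᵢ B(aᵢ,bᵢ)`) and any one with integrand `q·∏ᵢ xᵢ^{a′ᵢ−1}(1−xᵢ)^{b′ᵢ−1}` of the same value are KZ-equivalent.
`k = 1` is `BetaLinearSector` (3897), `k = 2` is `BetaProductSector` (3898) — `betaWordSector_one_iff`,
`betaWordSector_two_iff`. [this node] -/
def BetaWordSector (k : ℕ) : Prop :=
  ∀ (a b a' b' : Fin k → ℚ) (q : ℝ), (∀ i, 0 < a i) → (∀ i, 0 < b i) → (∀ i, 0 < a' i) → (∀ i, 0 < b' i) →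
    IsAlgebraic ℚ q → ∀ (r r' : KZ.IntegralRep k), r.domain = {x | ∀ i, x i ∈ Set.Ioo (0:ℝ) 1} →
    Set.EqOn r.integrand (fun x => ∏ i, (x i) ^ ((a i : ℝ) - 1) * (1 - x i) ^ ((b i : ℝ) - 1)) r.domain →
    r'.domain = {x | ∀ i, x i ∈ Set.Ioo (0:ℝ) 1} →
    Set.EqOn r'.integrand (fun x => q * ∏ i, (x i) ^ ((a' i : ℝ) - 1) * (1 - x i) ^ ((b' i : ℝ) - 1)) r'.domain →
    r.value = r'.value → KZ.Equivalent r r'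

/-- The open unit interval as a subset of `ℝ¹`, in the two spellings of 3897 and of the word sector. [bookkeeping] -/
theorem cube_one_eq : ({x | x 0 ∈ Set.Ioo (0:ℝ) 1} : Set (Fin 1 → ℝ)) = {x | ∀ i, x i ∈ Set.Ioo (0:ℝ) 1} := by
  ext x
  simp only [Set.mem_setOf_eq, Fin.forall_fin_one]

/-- **`BetaWordSector 1 ↔ BetaLinearSector` (3897).** [this node] -/
theorem betaWordSector_one_iff : BetaWordSector 1 ↔ BetaLinearSector := by
  constructor
  · intro h a b a' b' c ha hb ha' hb' hc r r' hr hi hr' hi' hv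
    refine h ![a] ![b] ![a'] ![b'] c ?_ ?_ ?_ ?_ hc r r' (hr.trans cube_one_eq) ?_ (hr'.trans cube_one_eq) ?_ hv
    · intro i; fin_cases i; simpa using ha
    · intro i; fin_cases i; simpa using hb
    · intro i; fin_cases i; simpa using ha'
    · intro i; fin_cases i; simpa using hb'
    · intro x hx
      rw [hi hx]
      simp only [Fin.prod_univ_one, Fin.isValue, Matrix.cons_val_fin_one]
    · intro x hx
      rw [hi' hx]
      simp only [Fin.prod_univ_one, Fin.isValue, Matrix.cons_val_fin_one]
      ring
  · intro h a b a' b' q ha hb ha' hb' hq r r' hr hi hr' hi' hv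
    refine h (a 0) (b 0) (a' 0) (b' 0) q (ha 0) (hb 0) (ha' 0) (hb' 0) hq r r' (hr.trans cube_one_eq.symm) ?_
      (hr'.trans cube_one_eq.symm) ?_ hv
    · intro x hx
      rw [hi hx]
      simp only [Fin.prod_univ_one]
    · intro x hx
      rw [hi' hx]
      simp only [Fin.prod_univ_one]
      ring

/-- **`BetaWordSector 2 ↔ BetaProductSector` (3898).** [this node] -/
theorem betaWordSector_two_iff : BetaWordSector 2 ↔ BetaProductSector := by
  constructor
  · intro h a b e d a' b' e' d' q ha hb he hd ha' hb' he' hd' hq r r' hr hi hr' hi' hv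
    refine h ![a, e] ![b, d] ![a', e'] ![b', d'] q ?_ ?_ ?_ ?_ hq r r' hr ?_ hr' ?_ hv
    · intro i
      fin_cases i
      · simpa using ha
      · simpa using he
    · intro i
      fin_cases i
      · simpa using hb
      · simpa using hd
    · intro i
      fin_cases i
      · simpa using ha'
      · simpa using he'
    · intro i
      fin_cases i
      · simpa using hb'
      · simpa using hd'
    · intro x hx
      rw [hi hx]
      simp only [Fin.prod_univ_two, Fin.isValue, Matrix.cons_val_zero, Matrix.cons_val_one]
      ring
    · intro x hx
      rw [hi' hx]
      simp only [Fin.prod_univ_two, Fin.isValue, Matrix.cons_val_zero, Matrix.cons_val_one]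
      ring
  · intro h a b a' b' q ha hb ha' hb' hq r r' hr hi hr' hi' hv
    refine h (a 0) (b 0) (a 1) (b 1) (a' 0) (b' 0) (a' 1) (b' 1) q (ha 0) (hb 0) (ha 1) (hb 1) (ha' 0) (hb' 0)
      (ha' 1) (hb' 1) hq r r' hr ?_ hr' ?_ hv
    · intro x hx
      rw [hi hx]
      simp only [Fin.prod_univ_two]
      ring
    · intro x hx
      rw [hi' hx]
      simp only [Fin.prod_univ_two]
      ring

/-! ### Monotonicity in the word length: padding with the letter `B(1,1) = ∫₀¹ dt = 1` -/

/-- **Padding move.** A representation `R` on the open cube `(0,1)^{k+1}` whose integrand is `z ↦ g (init z)` there,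
and a representation `s` on the open cube `(0,1)^k` with integrand `g`, differ by KZ moves: `[R] − [s] ∈ relations`
(`[R]` is a null modification of the closed slab `[s.slab 0] = [σ × [0,1], g ∘ init]` — the difference of the domains lies
in the two hyperplanes `z_last = 0, 1` — and `[s.slab 0] − [s]` is one Newton–Leibniz move,
`KZ.IntegralRep.of_slab_sub_of_mem_newtonLeibnizRel`). [KZ 2001, §1.2 rules (1), (3); this node] -/
theorem of_sub_of_mem_relations_of_pad {k : ℕ} (R : KZ.IntegralRep (k + 1)) (s : KZ.IntegralRep k)
    (hRd : R.domain = {z | ∀ i, z i ∈ Set.Ioo (0:ℝ) 1}) (hsd : s.domain = {x | ∀ i, x i ∈ Set.Ioo (0:ℝ) 1})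
    (hRi : Set.EqOn R.integrand (fun z => s.integrand (Fin.init z)) R.domain) :
    KZ.of R - KZ.of s ∈ KZ.relations := by
  have e1 : KZ.of R - KZ.of (s.slab 0) ∈ KZ.relations := by
    refine KZ.of_sub_of_mem_relations_of_null R (s.slab 0) ?_ ?_ ?_
    · have h0 : R.domain \ (s.slab 0).domain = ∅ := by
        rw [Set.sdiff_eq_empty]
        intro z hz
        rw [hRd] at hz
        simp only [KZ.IntegralRep.domain_slab, KZ.IntegralRep.slabDomain, hsd, Set.mem_setOf_eq, Nat.cast_zero,
          zero_add]
        exact ⟨fun i => hz (Fin.castSucc i), (hz (Fin.last k)).1.le, (hz (Fin.last k)).2.le⟩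
      rw [h0]
      exact measure_empty
    · refine measure_mono_null (t := {z | z (Fin.last k) = 0} ∪ {z | z (Fin.last k) = 1}) ?_ ?_
      · rintro z ⟨hz, hnot⟩
        rw [hRd] at hnot
        simp only [KZ.IntegralRep.domain_slab, KZ.IntegralRep.slabDomain, hsd, Set.mem_setOf_eq, Nat.cast_zero,
          zero_add] at hz
        obtain ⟨hinit, h0, h1⟩ := hz
        simp only [Set.mem_setOf_eq, not_forall] at hnot
        obtain ⟨i, hi⟩ := hnot
        by_cases hil : i = Fin.last k
        · subst hil
          simp only [Set.mem_Ioo, not_and_or, not_lt] at hi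
          rcases hi with hi | hi
          · exact Or.inl (le_antisymm hi h0)
          · exact Or.inr (le_antisymm h1 hi)
        · obtain ⟨j, rfl⟩ := Fin.exists_castSucc_eq.mpr hil
          exact absurd (hinit j) hi
      · exact measure_union_null (by rw [MeasureTheory.volume_pi]; exact Measure.pi_hyperplane _ _ _)
          (by rw [MeasureTheory.volume_pi]; exact Measure.pi_hyperplane _ _ _)
    · intro z hz
      rw [hRi hz.1]
      simp only [KZ.IntegralRep.integrand_slab]
  have e2 : KZ.of (s.slab 0) - KZ.of s ∈ KZ.relations :=
    KZ.newtonLeibnizRel_subset_relations (s.of_slab_sub_of_mem_newtonLeibnizRel 0)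
  have e : KZ.of R - KZ.of s = (KZ.of R - KZ.of (s.slab 0)) + (KZ.of (s.slab 0) - KZ.of s) := by abel
  rw [e]
  exact KZ.relations.add_mem e1 e2

/-- Positivity of padded exponent data. [bookkeeping] -/
theorem snoc_one_pos {k : ℕ} (c : Fin k → ℚ) (hc : ∀ i, 0 < c i) : ∀ i, 0 < (Fin.snoc c (1:ℚ) : Fin (k + 1) → ℚ) i := by
  intro i
  refine Fin.lastCases ?_ (fun j => ?_) i
  · simp [Fin.snoc_last]
  · simp [Fin.snoc_castSucc, hc j]

/-- The padded Beta-word integrand restricted to the first `k` letters: the last letter `t^{1−1}(1−t)^{1−1} = 1` drops.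
[bookkeeping] -/
theorem prod_snoc_one {k : ℕ} (c d : Fin k → ℚ) (z : Fin (k + 1) → ℝ) :
    (∏ i, (z i) ^ (((Fin.snoc c (1:ℚ) : Fin (k + 1) → ℚ) i : ℝ) - 1) *
        (1 - z i) ^ (((Fin.snoc d (1:ℚ) : Fin (k + 1) → ℚ) i : ℝ) - 1))
      = ∏ i, (Fin.init z i) ^ ((c i : ℝ) - 1) * (1 - Fin.init z i) ^ ((d i : ℝ) - 1) := by
  rw [Fin.prod_univ_castSucc]
  simp only [Fin.snoc_castSucc, Fin.snoc_last, Rat.cast_one, sub_self, Real.rpow_zero, mul_one, Fin.init]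

/-- **Monotonicity of the word sector: `BetaWordSector (k+1) → BetaWordSector k`.** Pad both `k`-words with the letter
`(a, b) = (1, 1)`: the padded `(k+1)`-dimensional representations differ from the given ones by KZ moves
(`of_sub_of_mem_relations_of_pad`), hence have the same values (`KZ.Equivalent.value_eq_holds`); the `(k+1)`-sector
hypothesis makes them equivalent, and the moves compose. So the family `BetaWordSector k` is a GENUINE TOWER over
3897 (`k = 1`) and 3898 (`k = 2`): `BetaWordSector 3 → BetaProductSector → BetaLinearSector`. [this node] -/
theorem betaWordSector_anti {k : ℕ} (h : BetaWordSector (k + 1)) : BetaWordSector k := by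
  intro a b a' b' q ha hb ha' hb' hq r r' hr hi hr' hi' hv
  obtain ⟨R, hRd, hRi⟩ := KZ.exists_cubeBetaRep (Fin.snoc a (1:ℚ)) (Fin.snoc b (1:ℚ))
    (fun j => ⟨snoc_one_pos a ha j, snoc_one_pos b hb j⟩)
  obtain ⟨R₀, hR₀d, hR₀i⟩ := KZ.exists_cubeBetaRep (Fin.snoc a' (1:ℚ)) (Fin.snoc b' (1:ℚ))
    (fun j => ⟨snoc_one_pos a' ha' j, snoc_one_pos b' hb' j⟩)
  have eR : KZ.of R - KZ.of r ∈ KZ.relations := by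
    refine of_sub_of_mem_relations_of_pad R r hRd hr fun z hz => ?_
    have hm : Fin.init z ∈ r.domain := by
      rw [hr]; rw [hRd] at hz; exact fun i => hz (Fin.castSucc i)
    show R.integrand z = r.integrand (Fin.init z)
    rw [hRi hz, hi hm]
    exact prod_snoc_one a b z
  have hR'd : (R₀.constMul q hq).domain = {z | ∀ i, z i ∈ Set.Ioo (0:ℝ) 1} := hR₀d
  have hR'i : Set.EqOn (R₀.constMul q hq).integrand
      (fun x => q * ∏ i, (x i) ^ (((Fin.snoc a' (1:ℚ) : Fin (k + 1) → ℚ) i : ℝ) - 1) *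
        (1 - x i) ^ (((Fin.snoc b' (1:ℚ) : Fin (k + 1) → ℚ) i : ℝ) - 1)) (R₀.constMul q hq).domain := by
    intro z hz
    simp only [KZ.IntegralRep.integrand_constMul]
    rw [hR₀i hz]
  have eR' : KZ.of (R₀.constMul q hq) - KZ.of r' ∈ KZ.relations := by
    refine of_sub_of_mem_relations_of_pad (R₀.constMul q hq) r' hR'd hr' fun z hz => ?_
    have hm : Fin.init z ∈ r'.domain := by
      rw [hr']; rw [hR'd] at hz; exact fun i => hz (Fin.castSucc i)
    show q * R₀.integrand z = r'.integrand (Fin.init z)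
    rw [hR₀i hz, hi' hm]
    simp only [prod_snoc_one a' b' z]
  have hRv : R.value = r.value := KZ.Equivalent.value_eq_holds eR
  have hR'v : (R₀.constMul q hq).value = r'.value := KZ.Equivalent.value_eq_holds eR'
  have H : KZ.Equivalent R (R₀.constMul q hq) :=
    h _ _ _ _ q (snoc_one_pos a ha) (snoc_one_pos b hb) (snoc_one_pos a' ha') (snoc_one_pos b' hb') hq R
      (R₀.constMul q hq) hRd hRi hR'd hR'i (by rw [hRv, hR'v, hv])
  have e : KZ.of r - KZ.of r' =
      -(KZ.of R - KZ.of r) + (KZ.of R - KZ.of (R₀.constMul q hq)) + (KZ.of (R₀.constMul q hq) - KZ.of r') := by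
    abel
  show KZ.of r - KZ.of r' ∈ KZ.relations
  rw [e]
  exact KZ.relations.add_mem (KZ.relations.add_mem (KZ.relations.neg_mem eR) H) eR'

/-- **The tower, iterated: `BetaWordSector (k + j) → BetaWordSector k`.** [this node] -/
theorem betaWordSector_of_le {k l : ℕ} (hkl : k ≤ l) (h : BetaWordSector l) : BetaWordSector k := by
  obtain ⟨j, rfl⟩ := Nat.exists_eq_add_of_le hkl
  induction j with
  | zero => simpa using h
  | succ j ih => exact ih (Nat.le_add_right k j) (betaWordSector_anti h)

/-- **Case `k = 1` of the tower: crux 3898 implies crux 3897**, `BetaProductSector → BetaLinearSector` (through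
`betaWordSector_two_iff` / `betaWordSector_one_iff`). KNOWN in the tree as
`Summit.KontsevichZagierPeriods.FermatIsogeny.BetaLinearOfProduct.betaLinearSector_of_betaProductSector`
(`Theorems/FermatIsogenyBetaLinearOfProduct.lean`, via `β(1,1) = 1` in `P`); re-derived here from the uniform slab move as
a consistency check of the word-sector typing — no novelty claimed for this case. [tree; this node] -/
theorem betaLinearSector_of_betaProductSector' (h : BetaProductSector) : BetaLinearSector :=
  betaWordSector_one_iff.mp (betaWordSector_anti (betaWordSector_two_iff.mpr h))

/-- `BetaWordSector 3` (the home of `Deep65`) implies both sector cruxes of route FermatIsogeny. [this node] -/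
theorem sectors_of_betaWordSector_three (h : BetaWordSector 3) : BetaProductSector ∧ BetaLinearSector :=
  ⟨betaWordSector_two_iff.mp (betaWordSector_anti h),
    betaWordSector_one_iff.mp (betaWordSector_anti (betaWordSector_anti h))⟩

/-! ### Bridge: the summit splits as (the word tower) ∧ (completeness of the calculus modulo the word pairs) -/

/-- **The Beta-word tower**: every `k`-letter Beta-word sector of Conjecture 1 holds. By `betaWordSector_of_le` every
truncation `BetaWordSector k` follows from any higher one; `k = 2, 1` are the route's cruxes 3898, 3897. [this node] -/
def BetaWordTower : Prop := ∀ k, BetaWordSector k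

end Summit.KontsevichZagierPeriods.FermatIsogeny.DeepTargets
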